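import Literature.Topology.FourManifolds.TrisectionsFaceNormalForm
import Literature.Topology.FourManifolds.TrisectionsAmbientMorseLemmas
import Literature.Topology.FourManifolds.TrisectionsImplantModel
import Literature.Topology.FourManifolds.MorseProofs
import Literature.Topology.FourManifolds.SPC4HandleChainProofs
import HarnessLib

/-!
# Making the collar coefficient of a face constant near a point of the corner locus

Topic `Literature/Topology/FourManifolds`; infrastructure for the fact seat
`provefact-Literature.Topology.FourManifolds.exists-14560f9fc8` (named fact (c′)
`Literature.Topology.FourManifolds.exists_stabilized_gkTrisection`, Gay–Kirby 2016, Def. 8 and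
Lemma 10).  Everything in this file is **proved**; no definitions, no named facts.

**Theorem (`FaceNormalForm.exists_morse_const`).**  *A face in normal form
(`FaceNormalForm Q F u_a v_a U c`) admits, for every `x ∈ F`, Morse data `(Φ, G, λ, Oλ)` as in
the normal form with, in addition, `λ` constant on a neighbourhood `Bx` of `x`.*  This is the
face analogue of `SectorNormalForm.exists_morse_const` (`TrisectionsKappaConst.lean`), used to
prepare the faces for the stabilisation implant.  Replace `λ` by
`λ̃ = (1 - χ) λ + χ λ(x)` and `G` by `G̃ = G + v_a χ (λ - λ(x))`, `χ = χ₁(‖Θ y - Θ x‖²/η)` a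
cutoff in the boundary slice chart `Θ` of `Q` at `x`: on the face, written in that chart,
`G̃ = 1 - V Λ̃` with `dV ≠ 0` at the image of `x` (regularity of `G|Q` at `x`), `Λ̃ ≥ λ(x)/2`
and `‖dΛ̃‖` bounded uniformly in `η` while `|V| ≤ L √η` on the support of `χ`, so `G̃|Q` has
no critical point where it differs from `G|Q` once `η` is small; elsewhere the Morse data are
those of `G|Q`.

## References

* D. Gay, R. Kirby, *Trisecting 4-manifolds*, Geom. Topol. 20 (2016), Def. 8, Lemma 10.
  [GayKirby2016]
* J. Milnor, *Morse theory* (1963), §2. [Milnor1963]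
-/

open scoped Manifold ContDiff Topology Classical
open Set Function Filter Metric

noncomputable section

namespace Literature.Topology.FourManifolds

universe u

section LambdaConst

variable {X : Type u} [TopologicalSpace X] [T2Space X]
  [ChartedSpace (EuclideanSpace ℝ (Fin 4)) X] [IsManifold (𝓡 4) ∞ X]

omit [IsManifold (𝓡 4) ∞ X] in
/-- **A smooth cutoff localised in a chart ball.**  For a local homeomorphism `Θ` of `X` into
`ℝ⁴`, smooth on its source, a point `z₀` with `closedBall z₀ r ⊆ Θ.target` and `0 < η ≤ r²`,
the function `χ y = χ₁(‖Θ y - z₀‖²/η)` on the source, `0` elsewhere, is smooth on `X`, takes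
values in `[0, 1]`, equals `1` where `‖Θ y - z₀‖² ≤ η/2` and `0` where `Θ y ∉ closedBall z₀ √η`
or `y ∉ Θ.source`. [folklore] -/
theorem exists_chart_cutoff {Θ : OpenPartialHomeomorph X (EuclideanSpace ℝ (Fin 4))}
    (hΘ : ContMDiffOn (𝓡 4) 𝓘(ℝ, EuclideanSpace ℝ (Fin 4)) ∞ Θ Θ.source)
    {z₀ : EuclideanSpace ℝ (Fin 4)} {r η : ℝ} (hr0 : 0 < r) (hr : closedBall z₀ r ⊆ Θ.target)
    (hη : 0 < η) (hηr : η ≤ r ^ 2) :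
    ∃ χ : X → ℝ, ContMDiff (𝓡 4) 𝓘(ℝ, ℝ) ∞ χ ∧ (∀ y, 0 ≤ χ y ∧ χ y ≤ 1) ∧
      (∀ y ∈ Θ.source, χ y = Real.smoothTransition (2 - 2 * (‖Θ y - z₀‖ ^ 2 / η))) ∧
      (∀ y ∈ Θ.source, ‖Θ y - z₀‖ ^ 2 ≤ η / 2 → χ y = 1) ∧
      (∀ y, (y ∈ Θ.source → η < ‖Θ y - z₀‖ ^ 2) → χ y = 0) := by
  obtain ⟨hχ₁s, hχ₁01, hχ₁one, hχ₁zero, -⟩ := cutoffProfile_props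
  set χ : X → ℝ := fun y => if y ∈ Θ.source then Real.smoothTransition (2 - 2 * (‖Θ y - z₀‖ ^ 2 / η)) else 0
    with hχdef
  have hχsrc : ∀ y ∈ Θ.source, χ y = Real.smoothTransition (2 - 2 * (‖Θ y - z₀‖ ^ 2 / η)) :=
    fun y hy => by simp only [hχdef, hy, if_true]
  have hχout : ∀ y, (y ∈ Θ.source → η < ‖Θ y - z₀‖ ^ 2) → χ y = 0 := by
    intro y hy
    by_cases hys : y ∈ Θ.source
    · rw [hχsrc y hys]
      exact hχ₁zero _ (by rw [le_div_iff₀ hη]; linarith [hy hys])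
    · simp only [hχdef, hys, if_false]
  -- the compact set carrying `χ`
  set Kc : Set X := Θ.symm '' closedBall z₀ (Real.sqrt η) with hKc
  have hsub : closedBall z₀ (Real.sqrt η) ⊆ closedBall z₀ r := by
    apply closedBall_subset_closedBall
    calc Real.sqrt η ≤ Real.sqrt (r ^ 2) := Real.sqrt_le_sqrt hηr
      _ = r := Real.sqrt_sq hr0.le
  have hKcc : IsCompact Kc :=
    (isCompact_closedBall _ _).image_of_continuousOn (Θ.continuousOn_symm.mono (hsub.trans hr))
  have hKcsrc : Kc ⊆ Θ.source := by
    rintro _ ⟨z, hz, rfl⟩; exact Θ.map_target (hr (hsub hz))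
  have hχoff : ∀ y ∉ Kc, χ y = 0 := by
    intro y hy
    apply hχout y
    intro hys
    by_contra hle
    push Not at hle
    apply hy
    refine ⟨Θ y, ?_, Θ.left_inv hys⟩
    rw [mem_closedBall, dist_eq_norm]
    calc ‖Θ y - z₀‖ = Real.sqrt (‖Θ y - z₀‖ ^ 2) := (Real.sqrt_sq (norm_nonneg _)).symm
      _ ≤ Real.sqrt η := Real.sqrt_le_sqrt hle
  have hχs : ContMDiff (𝓡 4) 𝓘(ℝ, ℝ) ∞ χ := by
    intro y
    by_cases hys : y ∈ Θ.source
    · have heq : χ =ᶠ[𝓝 y] fun y => Real.smoothTransition (2 - 2 * (‖Θ y - z₀‖ ^ 2 / η)) := by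
        filter_upwards [Θ.open_source.mem_nhds hys] with y' hy' using hχsrc y' hy'
      refine ContMDiffAt.congr_of_eventuallyEq ?_ heq
      have h1 : ContMDiffAt (𝓡 4) 𝓘(ℝ, EuclideanSpace ℝ (Fin 4)) ∞ Θ y :=
        hΘ.contMDiffAt (Θ.open_source.mem_nhds hys)
      have h2 : ContDiff ℝ ∞ fun z : EuclideanSpace ℝ (Fin 4) =>
          Real.smoothTransition (2 - 2 * (‖z - z₀‖ ^ 2 / η)) :=
        hχ₁s.comp (((contDiff_id.sub contDiff_const).norm_sq ℝ).div_const η)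
      exact ((contMDiff_iff_contDiff.2 h2).contMDiffAt).comp y h1
    · have hyK : y ∉ Kc := fun h => hys (hKcsrc h)
      have heq : χ =ᶠ[𝓝 y] fun _ => 0 := by
        filter_upwards [hKcc.isClosed.isOpen_compl.mem_nhds hyK] with y' hy' using hχoff y' hy'
      exact contMDiffAt_const.congr_of_eventuallyEq heq
  refine ⟨χ, hχs, fun y => ?_, hχsrc, fun y hy hle => ?_, hχout⟩
  · by_cases hys : y ∈ Θ.source
    · rw [hχsrc y hys]; exact hχ₁01 _
    · simp only [hχdef, hys, if_false]; exact ⟨le_rfl, zero_le_one⟩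
  · rw [hχsrc y hy]
    exact hχ₁one _ (by rw [div_le_iff₀ hη]; linarith)

set_option maxHeartbeats 800000 in
/-- **The collar coefficient made constant near a point of the corner locus.**  See the module
docstring. [cite: GayKirby2016, Def. 8; Milnor1963, §2] -/
theorem FaceNormalForm.exists_morse_const {Q F : Set X} {ua va : X → ℝ} {U : Set X} {c : ℕ → ℕ}
    (hQ : FaceNormalForm Q F ua va U c) {x : X} (hx : x ∈ F) :
    ∃ (Φ : BoundarySliceAtlas 2 Q) (G lam : X → ℝ) (Ol Bx : Set X),
      (∀ p : ↥Q, (Φ.datum p).Θ p.1 0 = 0 ↔ p.1 ∈ F) ∧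
      ContMDiff (𝓡 4) 𝓘(ℝ, ℝ) ∞ G ∧ ContMDiff (𝓡 4) 𝓘(ℝ, ℝ) ∞ lam ∧ IsOpen Ol ∧ F ⊆ Ol ∧ Ol ⊆ U ∧
      (∀ y ∈ Ol, 0 < lam y) ∧ (∀ y ∈ Ol, G y = 1 - va y * lam y) ∧
      (∀ p ∈ Q, p ∉ F → G p < 1) ∧
      (letI := Φ.chartedSpace
       (∀ p : ↥Q, IsMCriticalPt (𝓡∂ 3) (G ∘ Subtype.val : ↥Q → ℝ) p →
          p.1 ∉ F ∧ (mhessian (𝓡∂ 3) (G ∘ Subtype.val : ↥Q → ℝ) p).Nondegenerate) ∧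
       ∀ n, (criticalSetOfIndex (𝓡∂ 3) (G ∘ Subtype.val : ↥Q → ℝ) n).ncard = c n) ∧
      IsOpen Bx ∧ x ∈ Bx ∧ Bx ⊆ Ol ∧ ∀ y ∈ Bx, lam y = lam x := by
  obtain ⟨Φ, G, lam, Ol, hdet, hGs, hlams, hOlo, hFOl, hOlU, hlampos, hGform, hGlt, hcrit, hcount⟩ := hQ.morse
  letI := Φ.chartedSpace
  haveI := Φ.isManifold
  have hxQ : x ∈ Q := hQ.F_subset hx
  set px : ↥Q := ⟨x, hxQ⟩ with hpx
  set D₀ := Φ.datum px with hD₀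
  have hxD : x ∈ D₀.Θ.source := Φ.mem_source px
  set lam0 : ℝ := lam x with hlam0def
  have hlam0 : 0 < lam0 := hlampos x (hFOl hx)
  have hGval : ContMDiff (𝓡∂ 3) 𝓘(ℝ, ℝ) ∞ (G ∘ Subtype.val : ↥Q → ℝ) := hGs.comp Φ.contMDiff_subtype_val
  -- ### the chart at `x` and the chart functions
  set z₀ : EuclideanSpace ℝ (Fin 4) := D₀.Θ x with hz₀
  have hz₀T : z₀ ∈ D₀.Θ.target := D₀.Θ.map_source hxD
  have hz₀0 : z₀ 0 = 0 := (hdet px).2 hx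
  have hz₀last : z₀ (Fin.last 3) = 0 := D₀.apply_last_eq_zero hxD hxQ
  set w₀ : EuclideanSpace ℝ (Fin 3) := dropLast 2 z₀ with hw₀
  set σ : EuclideanSpace ℝ (Fin 3) → EuclideanSpace ℝ (Fin 4) := fun w => snocEquiv 3 (w, 0) with hσ
  have hσw₀ : σ w₀ = z₀ := snocEquiv_dropLast 2 hz₀last
  have hσs : ContDiff ℝ ∞ σ := by
    have : ContDiff ℝ ∞ fun w : EuclideanSpace ℝ (Fin 3) => (w, (0:ℝ)) := contDiff_id.prodMk contDiff_const
    exact (snocEquiv 3).contDiff.comp this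
  have hσnorm : ∀ w, ‖σ w - z₀‖ = ‖w - w₀‖ := by
    intro w
    have h1 : σ w - z₀ = snocEquiv 3 (w - w₀, 0) := by
      rw [← hσw₀]; simp only [hσ, ← map_sub, Prod.mk_sub_mk, sub_zero]
    have h2 := Implant.norm_sq_eq_dropLast (σ w - z₀)
    rw [h1, dropLast_snocEquiv, show (3 : Fin 4) = Fin.last 3 from rfl, snocEquiv_apply_last] at h2
    simp only [ne_eq, OfNat.ofNat_ne_zero, not_false_eq_true, zero_pow, add_zero] at h2
    rw [← h1] at h2
    exact (sq_eq_sq₀ (norm_nonneg _) (norm_nonneg _)).1 h2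
  -- the open set of the chart where `G = 1 - va · lam` holds
  set T₄ : Set (EuclideanSpace ℝ (Fin 4)) := D₀.Θ.target ∩ D₀.Θ.symm ⁻¹' Ol with hT₄
  have hT₄o : IsOpen T₄ := D₀.Θ.continuousOn_symm.isOpen_inter_preimage D₀.Θ.open_target hOlo
  have hz₀T₄ : z₀ ∈ T₄ := ⟨hz₀T, by show D₀.Θ.symm z₀ ∈ Ol; rw [hz₀, D₀.Θ.left_inv hxD]; exact hFOl hx⟩
  obtain ⟨r₂, hr₂, hballT₄⟩ := Metric.isOpen_iff.1 hT₄o z₀ hz₀T₄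
  set r₁ : ℝ := r₂ / 2 with hr₁def
  have hr₁ : 0 < r₁ := by positivity
  have hcballT₄ : closedBall z₀ r₁ ⊆ T₄ := (closedBall_subset_ball (by rw [hr₁def]; linarith)).trans hballT₄
  have hcballT : closedBall z₀ r₁ ⊆ D₀.Θ.target := fun z hz => (hcballT₄ hz).1
  set Vc : EuclideanSpace ℝ (Fin 4) → ℝ := va ∘ D₀.Θ.symm with hVc
  set Lc : EuclideanSpace ℝ (Fin 4) → ℝ := lam ∘ D₀.Θ.symm with hLc
  have hVcs : ContDiffOn ℝ ∞ Vc D₀.Θ.target :=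
    contMDiffOn_iff_contDiffOn.1 (hQ.contMDiff_col.comp_contMDiffOn D₀.contMDiffOn_symm)
  have hLcs : ContDiffOn ℝ ∞ Lc D₀.Θ.target :=
    contMDiffOn_iff_contDiffOn.1 (hlams.comp_contMDiffOn D₀.contMDiffOn_symm)
  -- the functions along the slice, on the open ball `B₃ = ball w₀ r₁` of `ℝ³`
  set B₃ : Set (EuclideanSpace ℝ (Fin 3)) := ball w₀ r₁ with hB₃
  have hσB₃ : ∀ w ∈ B₃, σ w ∈ ball z₀ r₁ := fun w hw => by
    rw [mem_ball, dist_eq_norm, hσnorm]; rwa [mem_ball, dist_eq_norm] at hw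
  have hσT : ∀ w ∈ B₃, σ w ∈ D₀.Θ.target := fun w hw => hcballT (ball_subset_closedBall (hσB₃ w hw))
  have hσOl : ∀ w ∈ B₃, D₀.Θ.symm (σ w) ∈ Ol := fun w hw => (hcballT₄ (ball_subset_closedBall (hσB₃ w hw))).2
  set V : EuclideanSpace ℝ (Fin 3) → ℝ := fun w => Vc (σ w) with hV
  set Λ : EuclideanSpace ℝ (Fin 3) → ℝ := fun w => Lc (σ w) with hΛ
  have hVs : ContDiffOn ℝ ∞ V B₃ := hVcs.comp hσs.contDiffOn fun w hw => hσT w hw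
  have hΛs : ContDiffOn ℝ ∞ Λ B₃ := hLcs.comp hσs.contDiffOn fun w hw => hσT w hw
  have hw₀B₃ : w₀ ∈ B₃ := mem_ball_self hr₁
  have hV₀ : V w₀ = 0 := by
    show va (D₀.Θ.symm (σ w₀)) = 0
    rw [hσw₀, hz₀, D₀.Θ.left_inv hxD]; exact ((hQ.memF_iff x (hQ.F_subset_U hx)).1 hx).2
  have hΛ₀ : Λ w₀ = lam0 := by
    show lam (D₀.Θ.symm (σ w₀)) = lam x
    rw [hσw₀, hz₀, D₀.Θ.left_inv hxD]
  -- ### criticality read in the chart at `x`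
  have hsrc_ext : ∀ p : ↥Q, p.1 ∈ D₀.Θ.source → p ∈ (extChartAt (𝓡∂ 3) px).source := by
    intro p hp
    rw [extChartAt_source]
    show p ∈ (D₀.chart px).source
    rw [D₀.chart_source]; exact hp
  have hext : extChartAt (𝓡∂ 3) px = (D₀.chart px).extend (𝓡∂ 3) := rfl
  have key_crit : ∀ {Gx : X → ℝ}, ContMDiff (𝓡 4) 𝓘(ℝ, ℝ) ∞ Gx → ∀ (p : ↥Q) (hp : p.1 ∈ D₀.Θ.source),
      dropLast 2 (D₀.Θ p.1) ∈ B₃ →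
      (IsMCriticalPt (𝓡∂ 3) (Gx ∘ Subtype.val : ↥Q → ℝ) p ↔
        fderiv ℝ (fun w => Gx (D₀.Θ.symm (σ w))) (dropLast 2 (D₀.Θ p.1)) = 0) := by
    intro Gx hGxs p hp hwB
    set wp : EuclideanSpace ℝ (Fin 3) := dropLast 2 (D₀.Θ p.1) with hwp
    have hGxval : ContMDiff (𝓡∂ 3) 𝓘(ℝ, ℝ) ∞ (Gx ∘ Subtype.val : ↥Q → ℝ) := hGxs.comp Φ.contMDiff_subtype_val
    have hmd : MDifferentiableAt (𝓡∂ 3) 𝓘(ℝ, ℝ) (Gx ∘ Subtype.val : ↥Q → ℝ) p :=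
      hGxval.mdifferentiableAt (by simp)
    rw [isMCriticalPt_iff_fderivWithin_writtenInExtChartAt_eq_zero (I := 𝓡∂ 3) (hsrc_ext p hp) hmd]
    have hwpeq : extChartAt (𝓡∂ 3) px p = wp := by
      rw [hext, D₀.extend_chart_apply (show p ∈ (D₀.chart px).source by rw [D₀.chart_source]; exact hp)]
    rw [hwpeq]
    have hσwp : σ wp = D₀.Θ p.1 := D₀.snocEquiv_dropLast_apply hp p.2
    have hwp0 : 0 ≤ wp 0 := by rw [hwp, dropLast_apply_zero]; exact D₀.apply_zero_nonneg hp p.2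
    have hwprange : wp ∈ range (𝓡∂ 3) := by rw [range_modelWithCornersEuclideanHalfSpace]; exact hwp0
    -- the smooth model function
    set ψ : EuclideanSpace ℝ (Fin 3) → ℝ := fun w => Gx (D₀.Θ.symm (σ w)) with hψ
    have hψs : ContDiffOn ℝ ∞ ψ B₃ := by
      have h1 := contMDiffOn_iff_contDiffOn.1 (hGxs.comp_contMDiffOn D₀.contMDiffOn_symm)
      exact h1.comp hσs.contDiffOn fun w hw => hσT w hw
    have hψd : DifferentiableAt ℝ ψ wp :=
      (hψs.differentiableOn (by simp)).differentiableAt (isOpen_ball.mem_nhds hwB)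
    have hwritten : ∀ w ∈ B₃, 0 ≤ w 0 →
        writtenInExtChartAt (𝓡∂ 3) 𝓘(ℝ, ℝ) px (Gx ∘ Subtype.val : ↥Q → ℝ) w = ψ w := by
      intro w hw hw0
      simp only [writtenInExtChartAt, extChartAt_model_space_eq_id, PartialEquiv.refl_coe, id_eq, comp_apply]
      rw [hext, D₀.coe_extend_chart_symm_of_mem hw0 (hσT w hw)]
    have hagree : writtenInExtChartAt (𝓡∂ 3) 𝓘(ℝ, ℝ) px (Gx ∘ Subtype.val : ↥Q → ℝ)
        =ᶠ[𝓝[range (𝓡∂ 3)] wp] ψ := by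
      have h1 : ∀ᶠ w in 𝓝[range (𝓡∂ 3)] wp, w ∈ B₃ :=
        Filter.Eventually.filter_mono nhdsWithin_le_nhds (isOpen_ball.mem_nhds hwB)
      filter_upwards [h1, self_mem_nhdsWithin] with w hw hwr
      rw [range_modelWithCornersEuclideanHalfSpace] at hwr
      exact hwritten w hw hwr
    rw [hagree.fderivWithin_eq (hwritten wp hwB hwp0),
      hψd.hasFDerivAt.hasFDerivWithinAt.fderivWithin ((𝓡∂ 3).uniqueDiffOn wp hwprange)]
  -- ### regularity of `G|Q` at `x`: `dV(w₀) ≠ 0`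
  have hregx : ¬ IsMCriticalPt (𝓡∂ 3) (G ∘ Subtype.val : ↥Q → ℝ) px := fun h => (hcrit px h).1 hx
  have hψG : ∀ w ∈ B₃, G (D₀.Θ.symm (σ w)) = 1 - V w * Λ w := fun w hw => hGform _ (hσOl w hw)
  have hVd : ∀ w ∈ B₃, DifferentiableAt ℝ V w := fun w hw =>
    (hVs.differentiableOn (by simp)).differentiableAt (isOpen_ball.mem_nhds hw)
  have hΛd : ∀ w ∈ B₃, DifferentiableAt ℝ Λ w := fun w hw =>
    (hΛs.differentiableOn (by simp)).differentiableAt (isOpen_ball.mem_nhds hw)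
  have hdV₀ : fderiv ℝ V w₀ ≠ 0 := by
    intro h0
    apply hregx
    rw [key_crit hGs px hxD (by rw [← hz₀]; exact hw₀B₃)]
    show fderiv ℝ (fun w => G (D₀.Θ.symm (σ w))) (dropLast 2 (D₀.Θ x)) = 0
    rw [← hz₀, ← hw₀]
    have heq : (fun w => G (D₀.Θ.symm (σ w))) =ᶠ[𝓝 w₀] fun w => 1 - V w * Λ w := by
      filter_upwards [isOpen_ball.mem_nhds hw₀B₃] with w hw using hψG w hw
    rw [heq.fderiv_eq]
    have hd : HasFDerivAt (fun w => 1 - V w * Λ w)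
        (0 - (V w₀ • fderiv ℝ Λ w₀ + Λ w₀ • fderiv ℝ V w₀)) w₀ :=
      (hasFDerivAt_const (1:ℝ) w₀).sub ((hVd w₀ hw₀B₃).hasFDerivAt.mul (hΛd w₀ hw₀B₃).hasFDerivAt)
    rw [hd.fderiv, hV₀, h0, zero_smul, smul_zero, add_zero, sub_zero]
  -- a direction `v₁` with `dV(w₀) v₁ = 1`
  obtain ⟨v₁, hv₁⟩ : ∃ v₁ : EuclideanSpace ℝ (Fin 3), fderiv ℝ V w₀ v₁ = 1 := by
    obtain ⟨u, hu⟩ : ∃ u, fderiv ℝ V w₀ u ≠ 0 := by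
      by_contra hall; push Not at hall; exact hdV₀ (ContinuousLinearMap.ext hall)
    exact ⟨(fderiv ℝ V w₀ u)⁻¹ • u, by rw [map_smul, smul_eq_mul, inv_mul_cancel₀ hu]⟩
  -- ### uniform constants on a closed ball `closedBall w₀ r₀ ⊆ B₃`
  have hcontdV : ContinuousOn (fun w => fderiv ℝ V w v₁) B₃ :=
    ((hVs.continuousOn_fderiv_of_isOpen isOpen_ball (by simp)).clm_apply continuousOn_const)
  obtain ⟨r₀, hr₀, hr₀r₁, hgood⟩ : ∃ r₀ : ℝ, 0 < r₀ ∧ r₀ < r₁ ∧ ∀ w ∈ closedBall w₀ r₀,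
      1 / 2 ≤ fderiv ℝ V w v₁ ∧ lam0 / 2 ≤ Λ w := by
    have h1 : ∀ᶠ w in 𝓝 w₀, 1 / 2 < fderiv ℝ V w v₁ := by
      have hc : ContinuousAt (fun w => fderiv ℝ V w v₁) w₀ :=
        hcontdV.continuousAt (isOpen_ball.mem_nhds hw₀B₃)
      exact hc.eventually (isOpen_Ioi.mem_nhds (show (1:ℝ) / 2 < fderiv ℝ V w₀ v₁ by rw [hv₁]; norm_num))
    have h2 : ∀ᶠ w in 𝓝 w₀, lam0 / 2 < Λ w := by
      have hc : ContinuousAt Λ w₀ := (hΛs.continuousOn.continuousAt (isOpen_ball.mem_nhds hw₀B₃))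
      exact hc.eventually (isOpen_Ioi.mem_nhds (show lam0 / 2 < Λ w₀ by rw [hΛ₀]; linarith))
    obtain ⟨ρ₀, hρ₀, hball⟩ := Metric.eventually_nhds_iff_ball.1 (h1.and h2)
    refine ⟨min (ρ₀ / 2) (r₁ / 2), by positivity, lt_of_le_of_lt (min_le_right _ _) (by linarith), ?_⟩
    intro w hw
    have hw' : w ∈ ball w₀ ρ₀ := by
      rw [mem_ball]; rw [mem_closedBall] at hw
      exact lt_of_le_of_lt hw (lt_of_le_of_lt (min_le_left _ _) (by linarith))
    obtain ⟨ha, hb⟩ := hball w hw'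
    exact ⟨ha.le, hb.le⟩
  set K₀ : Set (EuclideanSpace ℝ (Fin 3)) := closedBall w₀ r₀ with hK₀
  have hK₀B₃ : K₀ ⊆ B₃ := closedBall_subset_ball hr₀r₁
  have hK₀c : IsCompact K₀ := isCompact_closedBall _ _
  obtain ⟨LV, hLV⟩ := hK₀c.exists_bound_of_continuousOn
    ((hVs.continuousOn_fderiv_of_isOpen isOpen_ball (by simp)).mono hK₀B₃)
  obtain ⟨LΛ, hLΛ⟩ := hK₀c.exists_bound_of_continuousOn
    ((hΛs.continuousOn_fderiv_of_isOpen isOpen_ball (by simp)).mono hK₀B₃)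
  have hw₀K₀ : w₀ ∈ K₀ := mem_closedBall_self hr₀.le
  have hLV0 : 0 ≤ LV := le_trans (norm_nonneg _) (hLV w₀ hw₀K₀)
  have hLΛ0 : 0 ≤ LΛ := le_trans (norm_nonneg _) (hLΛ w₀ hw₀K₀)
  have hVbound : ∀ w ∈ K₀, |V w| ≤ LV * ‖w - w₀‖ := by
    intro w hw
    have h := (convex_closedBall w₀ r₀).norm_image_sub_le_of_norm_fderiv_le
      (fun w hw => hVd w (hK₀B₃ hw)) hLV hw₀K₀ hw
    rw [hV₀, sub_zero, Real.norm_eq_abs] at h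
    exact h
  have hΛbound : ∀ w ∈ K₀, |Λ w - lam0| ≤ LΛ * ‖w - w₀‖ := by
    intro w hw
    have h := (convex_closedBall w₀ r₀).norm_image_sub_le_of_norm_fderiv_le
      (fun w hw => hΛd w (hK₀B₃ hw)) hLΛ hw₀K₀ hw
    rw [hΛ₀, Real.norm_eq_abs] at h
    exact h
  -- ### no old critical points near `x`
  obtain ⟨ε, hε, hεnocrit⟩ : ∃ ε : ℝ, 0 < ε ∧ ∀ p : ↥Q, p.1 ∈ D₀.Θ.source → ‖D₀.Θ p.1 - z₀‖ < ε →
      ¬ IsMCriticalPt (𝓡∂ 3) (G ∘ Subtype.val : ↥Q → ℝ) p := by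
    have hclosed : IsClosed (criticalSet (𝓡∂ 3) (G ∘ Subtype.val : ↥Q → ℝ)) :=
      isClosed_criticalSet_of_contMDiff hGval (by norm_cast)
    have hopen : IsOpen ((criticalSet (𝓡∂ 3) (G ∘ Subtype.val : ↥Q → ℝ))ᶜ) := hclosed.isOpen_compl
    obtain ⟨OX, hOXo, hOXeq⟩ := isOpen_induced_iff.1 hopen
    have hxOX : x ∈ OX := by
      have : px ∈ Subtype.val ⁻¹' OX := by rw [hOXeq]; exact hregx
      exact this
    set W : Set (EuclideanSpace ℝ (Fin 4)) := D₀.Θ.target ∩ D₀.Θ.symm ⁻¹' OX with hW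
    have hWo : IsOpen W := D₀.Θ.continuousOn_symm.isOpen_inter_preimage D₀.Θ.open_target hOXo
    have hz₀W : z₀ ∈ W := ⟨hz₀T, by show D₀.Θ.symm z₀ ∈ OX; rw [hz₀, D₀.Θ.left_inv hxD]; exact hxOX⟩
    obtain ⟨ε, hε, hballW⟩ := Metric.isOpen_iff.1 hWo z₀ hz₀W
    refine ⟨ε, hε, fun p hp hdist hcritp => ?_⟩
    have hzW : D₀.Θ p.1 ∈ W := hballW (by rw [mem_ball, dist_eq_norm]; exact hdist)
    have hpOX : p.1 ∈ OX := by have := hzW.2; rwa [mem_preimage, D₀.Θ.left_inv hp] at this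
    have : p ∈ Subtype.val ⁻¹' OX := hpOX
    rw [hOXeq] at this
    exact this hcritp
  -- ### the profile and the choice of `η`
  obtain ⟨hχ₁s, hχ₁01, hχ₁one, hχ₁zero, Cχ, hCχ, hχ₁C⟩ := cutoffProfile_props
  set A : ℝ := LV * (LΛ * (1 + 2 * Cχ) * ‖v₁‖) with hA
  have hA0 : 0 ≤ A := by positivity
  obtain ⟨η, hη, hηr₀, hηε, hηsmall⟩ : ∃ η : ℝ, 0 < η ∧ Real.sqrt η ≤ r₀ ∧ Real.sqrt η < ε ∧
      Real.sqrt η * A < lam0 / 4 := by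
    set s₀ : ℝ := lam0 / (8 * (A + 1)) with hs₀
    have hs₀pos : 0 < s₀ := by positivity
    set t : ℝ := min (min r₀ (ε / 2)) s₀ with ht
    have htpos : 0 < t := lt_min (lt_min hr₀ (by positivity)) hs₀pos
    have hsq : Real.sqrt (t ^ 2) = t := Real.sqrt_sq htpos.le
    refine ⟨t ^ 2, by positivity, ?_, ?_, ?_⟩
    · rw [hsq]; exact (min_le_left _ _).trans (min_le_left _ _)
    · rw [hsq]; exact lt_of_le_of_lt ((min_le_left _ _).trans (min_le_right _ _)) (by linarith)
    · rw [hsq]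
      have h1 : t * A ≤ s₀ * A := mul_le_mul_of_nonneg_right (min_le_right _ _) hA0
      have h2 : s₀ * A < lam0 / 4 := by
        rw [hs₀]
        have hA1 : 0 < A + 1 := by positivity
        rw [div_mul_eq_mul_div, div_lt_iff₀ (by positivity)]
        nlinarith
      linarith
  have hsqη : Real.sqrt η < r₁ := lt_of_le_of_lt hηr₀ hr₀r₁
  have hηr₁ : η ≤ r₁ ^ 2 := by
    have := Real.sq_sqrt hη.le; nlinarith [Real.sqrt_nonneg η]
  -- ### the cutoff and the new functions
  obtain ⟨χ, hχs, hχ01, hχsrc, hχone, hχout⟩ :=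
    exists_chart_cutoff D₀.contMDiffOn_toFun hr₁ hcballT hη hηr₁
  set lamN : X → ℝ := fun y => (1 - χ y) * lam y + χ y * lam0 with hlamN
  set GN : X → ℝ := fun y => G y + va y * χ y * (lam y - lam0) with hGN
  have hlamNs : ContMDiff (𝓡 4) 𝓘(ℝ, ℝ) ∞ lamN :=
    ((contMDiff_const.sub hχs).mul hlams).add (hχs.mul contMDiff_const)
  have hGNs : ContMDiff (𝓡 4) 𝓘(ℝ, ℝ) ∞ GN :=
    hGs.add ((hQ.contMDiff_col.mul hχs).mul (hlams.sub contMDiff_const))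
  -- the zone where `χ` may be nonzero
  set Zs : Set X := D₀.Θ.symm '' closedBall z₀ (Real.sqrt η) with hZs
  have hZsc : IsCompact Zs := (isCompact_closedBall _ _).image_of_continuousOn
    (D₀.Θ.continuousOn_symm.mono ((closedBall_subset_closedBall hsqη.le).trans hcballT))
  have hχZ : ∀ y ∉ Zs, χ y = 0 := by
    intro y hy
    apply hχout y
    intro hys
    by_contra hle; push Not at hle
    apply hy
    refine ⟨D₀.Θ y, ?_, D₀.Θ.left_inv hys⟩
    rw [mem_closedBall, dist_eq_norm]
    calc ‖D₀.Θ y - z₀‖ = Real.sqrt (‖D₀.Θ y - z₀‖ ^ 2) := (Real.sqrt_sq (norm_nonneg _)).symm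
      _ ≤ Real.sqrt η := Real.sqrt_le_sqrt hle
  have hGN_far : ∀ y ∉ Zs, GN =ᶠ[𝓝 y] fun w => G w + 0 := by
    intro y hy
    filter_upwards [hZsc.isClosed.isOpen_compl.mem_nhds hy] with w hw
    simp only [hGN, hχZ w hw, mul_zero, zero_mul, add_zero]
  have hZs_src : ∀ y ∈ Zs, y ∈ D₀.Θ.source ∧ ‖D₀.Θ y - z₀‖ ≤ Real.sqrt η := by
    rintro _ ⟨z, hz, rfl⟩
    have hzT : z ∈ D₀.Θ.target := hcballT (closedBall_subset_closedBall hsqη.le hz)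
    refine ⟨D₀.Θ.map_target hzT, ?_⟩
    rw [D₀.Θ.right_inv hzT]; rw [mem_closedBall, dist_eq_norm] at hz; exact hz
  have hZs_Ol : Zs ⊆ Ol := by
    rintro _ ⟨z, hz, rfl⟩
    exact (hcballT₄ (closedBall_subset_closedBall hsqη.le hz)).2
  -- ### the neighbourhood `Bx`
  set Bx : Set X := D₀.Θ.source ∩ D₀.Θ ⁻¹' {z | ‖z - z₀‖ ^ 2 < η / 2} with hBx
  have hBxo : IsOpen Bx := by
    refine D₀.Θ.continuousOn.isOpen_inter_preimage D₀.Θ.open_source ?_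
    exact isOpen_lt (by fun_prop) continuous_const
  have hxBx : x ∈ Bx := ⟨hxD, by
    show ‖D₀.Θ x - z₀‖ ^ 2 < η / 2
    rw [← hz₀, sub_self, norm_zero, zero_pow two_ne_zero]; positivity⟩
  have hBxZs : Bx ⊆ Zs := by
    rintro y ⟨hys, hy⟩
    refine ⟨D₀.Θ y, ?_, D₀.Θ.left_inv hys⟩
    have hy' : ‖D₀.Θ y - z₀‖ ^ 2 < η / 2 := hy
    rw [mem_closedBall, dist_eq_norm]
    calc ‖D₀.Θ y - z₀‖ = Real.sqrt (‖D₀.Θ y - z₀‖ ^ 2) := (Real.sqrt_sq (norm_nonneg _)).symm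
      _ ≤ Real.sqrt η := Real.sqrt_le_sqrt (by linarith)
  have hlamN_Bx : ∀ y ∈ Bx, lamN y = lam0 := by
    rintro y ⟨hys, hy⟩
    have h1 : χ y = 1 := hχone y hys (le_of_lt hy)
    simp only [hlamN, h1, sub_self, zero_mul, one_mul, zero_add]
  -- ### the clauses on `Ol`
  have hlamNpos : ∀ y ∈ Ol, 0 < lamN y := by
    intro y hy
    have h1 := hχ01 y
    have h2 := hlampos y hy
    show 0 < (1 - χ y) * lam y + χ y * lam0
    rcases h1.2.lt_or_eq with hlt | heq1
    · exact add_pos_of_pos_of_nonneg (mul_pos (by linarith) h2) (mul_nonneg h1.1 hlam0.le)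
    · rw [heq1]; simp only [sub_self, zero_mul, one_mul, zero_add]; exact hlam0
  have hGNform : ∀ y ∈ Ol, GN y = 1 - va y * lamN y := by
    intro y hy
    simp only [hGN, hlamN, hGform y hy]; ring
  have hGNlt : ∀ p ∈ Q, p ∉ F → GN p < 1 := by
    intro p hpQ hpF
    by_cases hpZ : p ∈ Zs
    · have hpOl : p ∈ Ol := hZs_Ol hpZ
      have hpU : p ∈ U := hOlU hpOl
      obtain ⟨hu0, hv0⟩ := (hQ.mem_iff p hpU).1 hpQ
      have hva : 0 < va p := lt_of_le_of_ne hv0 fun h0 => hpF ((hQ.memF_iff p hpU).2 ⟨hu0, h0.symm⟩)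
      rw [hGNform p hpOl]
      nlinarith [mul_pos hva (hlamNpos p hpOl)]
    · simp only [hGN, hχZ p hpZ, mul_zero, zero_mul, add_zero]
      exact hGlt p hpQ hpF
  -- ### the estimate: no critical point of `GN|Q` in the zone
  have hχchart : ∀ w ∈ B₃, χ (D₀.Θ.symm (σ w)) = Real.smoothTransition (2 - 2 * (‖w - w₀‖ ^ 2 / η)) := by
    intro w hw
    have hys : D₀.Θ.symm (σ w) ∈ D₀.Θ.source := D₀.Θ.map_target (hσT w hw)
    rw [hχsrc _ hys, D₀.Θ.right_inv (hσT w hw), hσnorm]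
  set χh : EuclideanSpace ℝ (Fin 3) → ℝ := fun w => Real.smoothTransition (2 - 2 * (‖w - w₀‖ ^ 2 / η)) with hχh
  have hΨN : ∀ w ∈ B₃, GN (D₀.Θ.symm (σ w)) = 1 - V w * ((1 - χh w) * Λ w + χh w * lam0) := by
    intro w hw
    rw [hGNform _ (hσOl w hw)]
    show 1 - va (D₀.Θ.symm (σ w)) * ((1 - χ (D₀.Θ.symm (σ w))) * lam (D₀.Θ.symm (σ w)) +
      χ (D₀.Θ.symm (σ w)) * lam0) = _
    rw [hχchart w hw]
    rfl
  have hzone : ∀ w ∈ B₃, ‖w - w₀‖ ≤ Real.sqrt η →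
      fderiv ℝ (fun w => GN (D₀.Θ.symm (σ w))) w ≠ 0 := by
    intro w hw hwη h0
    have hwK₀ : w ∈ K₀ := by rw [hK₀, mem_closedBall, dist_eq_norm]; exact hwη.trans hηr₀
    obtain ⟨hdVw, hΛw⟩ := hgood w hwK₀
    -- derivatives along the line `s ↦ w + s v₁`
    have hlineGN : HasDerivAt (fun s : ℝ => GN (D₀.Θ.symm (σ (w + s • v₁)))) 0 0 := by
      have hd : DifferentiableAt ℝ (fun w => GN (D₀.Θ.symm (σ w))) w := by
        have h1 := contMDiffOn_iff_contDiffOn.1 (hGNs.comp_contMDiffOn D₀.contMDiffOn_symm)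
        have h2 : ContDiffOn ℝ ∞ (fun w => GN (D₀.Θ.symm (σ w))) B₃ :=
          h1.comp hσs.contDiffOn fun w hw => hσT w hw
        exact (h2.differentiableOn (by simp)).differentiableAt (isOpen_ball.mem_nhds hw)
      have h := hd.hasFDerivAt.hasLineDerivAt v₁
      unfold HasLineDerivAt at h
      rw [h0] at h
      simpa using h
    -- the explicit derivative of `s ↦ 1 - V Λ̃` along the line
    have hVline : HasDerivAt (fun s : ℝ => V (w + s • v₁)) (fderiv ℝ V w v₁) 0 := by
      have h := (hVd w hw).hasFDerivAt.hasLineDerivAt v₁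
      unfold HasLineDerivAt at h; exact h
    have hΛline : HasDerivAt (fun s : ℝ => Λ (w + s • v₁)) (fderiv ℝ Λ w v₁) 0 := by
      have h := (hΛd w hw).hasFDerivAt.hasLineDerivAt v₁
      unfold HasLineDerivAt at h; exact h
    have hρline : HasDerivAt (fun s : ℝ => ‖w + s • v₁ - w₀‖ ^ 2 / η) (2 * inner ℝ (w - w₀) v₁ / η) 0 := by
      have hfun : (fun s : ℝ => ‖w + s • v₁ - w₀‖ ^ 2 / η) =
          fun s => (‖w - w₀‖ ^ 2 + 2 * (s * inner ℝ (w - w₀) v₁) + s ^ 2 * ‖v₁‖ ^ 2) / η := by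
        funext s
        have : w + s • v₁ - w₀ = (w - w₀) + s • v₁ := by abel
        rw [this, norm_add_sq_real, real_inner_smul_right, norm_smul, mul_pow, Real.norm_eq_abs, sq_abs]
      rw [hfun]
      have h1 : HasDerivAt (fun s : ℝ => ‖w - w₀‖ ^ 2 + 2 * (s * inner ℝ (w - w₀) v₁) + s ^ 2 * ‖v₁‖ ^ 2)
          (0 + 2 * (1 * inner ℝ (w - w₀) v₁) + (2 * (0:ℝ) ^ 1 * 1) * ‖v₁‖ ^ 2) 0 := by
        refine ((hasDerivAt_const _ _).add (((hasDerivAt_id 0).mul_const _).const_mul 2)).add ?_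
        exact ((hasDerivAt_id (0:ℝ)).pow 2).mul_const _
      have h2 := h1.div_const η
      simp only [pow_one, mul_one, one_mul, mul_zero, zero_mul, add_zero, zero_add] at h2
      exact h2
    have hχline : HasDerivAt (fun s : ℝ => χh (w + s • v₁))
        (deriv (fun t : ℝ => Real.smoothTransition (2 - 2 * t)) (‖w - w₀‖ ^ 2 / η) *
          (2 * inner ℝ (w - w₀) v₁ / η)) 0 := by
      have hd : HasDerivAt (fun t : ℝ => Real.smoothTransition (2 - 2 * t))
          (deriv (fun t : ℝ => Real.smoothTransition (2 - 2 * t)) (‖w + (0:ℝ) • v₁ - w₀‖ ^ 2 / η))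
          (‖w + (0:ℝ) • v₁ - w₀‖ ^ 2 / η) :=
        ((hχ₁s.differentiable (by simp)) _).hasDerivAt
      have h := hd.comp 0 hρline
      simp only [zero_smul, add_zero] at h ⊢
      exact h
    set χ' : ℝ := deriv (fun t : ℝ => Real.smoothTransition (2 - 2 * t)) (‖w - w₀‖ ^ 2 / η) with hχ'def
    set dχ : ℝ := χ' * (2 * inner ℝ (w - w₀) v₁ / η) with hdχ
    set dVv : ℝ := fderiv ℝ V w v₁ with hdVv
    set dΛv : ℝ := fderiv ℝ Λ w v₁ with hdΛv
    have hmix : HasDerivAt (fun s : ℝ => (1 - χh (w + s • v₁)) * Λ (w + s • v₁) + χh (w + s • v₁) * lam0)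
        ((0 - dχ) * Λ w + (1 - χh w) * dΛv + dχ * lam0) 0 := by
      have h1 := ((hasDerivAt_const (0:ℝ) (1:ℝ)).sub hχline).mul hΛline
      have h2 := hχline.mul_const lam0
      have h := h1.add h2
      simp only [zero_smul, add_zero] at h
      refine h.congr_deriv ?_
      show (0 - dχ) * Λ w + (1 - χh (w + (0:ℝ) • v₁)) * dΛv + dχ * lam0 = _
      rw [zero_smul, add_zero]
    have hfull : HasDerivAt (fun s : ℝ => 1 - V (w + s • v₁) *
        ((1 - χh (w + s • v₁)) * Λ (w + s • v₁) + χh (w + s • v₁) * lam0))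
        (0 - (dVv * ((1 - χh w) * Λ w + χh w * lam0) + V w * ((0 - dχ) * Λ w + (1 - χh w) * dΛv + dχ * lam0))) 0 := by
      have h := (hasDerivAt_const (0:ℝ) (1:ℝ)).sub (hVline.mul hmix)
      simp only [zero_smul, add_zero] at h
      exact h
    -- the two functions agree near `0`
    have heq : (fun s : ℝ => GN (D₀.Θ.symm (σ (w + s • v₁)))) =ᶠ[𝓝 0] fun s => 1 - V (w + s • v₁) *
        ((1 - χh (w + s • v₁)) * Λ (w + s • v₁) + χh (w + s • v₁) * lam0) := by
      have hc : Tendsto (fun s : ℝ => w + s • v₁) (𝓝 0) (𝓝 w) := by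
        have : Continuous fun s : ℝ => w + s • v₁ := by fun_prop
        simpa using this.tendsto 0
      filter_upwards [hc.eventually (isOpen_ball.mem_nhds hw)] with s hs using hΨN _ hs
    have hderiv_eq : (0:ℝ) = 0 - (dVv * ((1 - χh w) * Λ w + χh w * lam0) +
        V w * ((0 - dχ) * Λ w + (1 - χh w) * dΛv + dχ * lam0)) :=
      hlineGN.unique (hfull.congr_of_eventuallyEq heq)
    -- ### the estimate
    have hχw := hχ₁01 (‖w - w₀‖ ^ 2 / η)
    have hmixge : lam0 / 2 ≤ (1 - χh w) * Λ w + χh w * lam0 := by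
      show lam0 / 2 ≤ (1 - Real.smoothTransition (2 - 2 * (‖w - w₀‖ ^ 2 / η))) * Λ w +
        Real.smoothTransition (2 - 2 * (‖w - w₀‖ ^ 2 / η)) * lam0
      nlinarith [hχw.1, hχw.2, hΛw, hlam0]
    have hVw : |V w| ≤ LV * Real.sqrt η := (hVbound w hwK₀).trans (mul_le_mul_of_nonneg_left hwη hLV0)
    have hdΛv : |dΛv| ≤ LΛ * ‖v₁‖ := by
      calc |dΛv| = ‖fderiv ℝ Λ w v₁‖ := (Real.norm_eq_abs _).symm
        _ ≤ ‖fderiv ℝ Λ w‖ * ‖v₁‖ := ContinuousLinearMap.le_opNorm _ _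
        _ ≤ LΛ * ‖v₁‖ := mul_le_mul_of_nonneg_right (hLΛ w hwK₀) (norm_nonneg _)
    have hdχ_bound : |dχ| * Real.sqrt η ≤ 2 * Cχ * ‖v₁‖ := by
      have h1 : |χ'| ≤ Cχ := hχ₁C _
      have h2 : |inner ℝ (w - w₀) v₁| ≤ ‖w - w₀‖ * ‖v₁‖ := abs_real_inner_le_norm _ _
      have h3 : |2 * inner ℝ (w - w₀) v₁ / η| ≤ 2 * (Real.sqrt η * ‖v₁‖) / η := by
        rw [abs_div, abs_mul, abs_of_pos hη, abs_two]
        gcongr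
        exact h2.trans (mul_le_mul_of_nonneg_right hwη (norm_nonneg _))
      calc |dχ| * Real.sqrt η = |χ'| * |2 * inner ℝ (w - w₀) v₁ / η| * Real.sqrt η := by rw [hdχ, abs_mul]
        _ ≤ Cχ * (2 * (Real.sqrt η * ‖v₁‖) / η) * Real.sqrt η := by gcongr
        _ = 2 * Cχ * ‖v₁‖ * (Real.sqrt η * Real.sqrt η / η) := by ring
        _ = 2 * Cχ * ‖v₁‖ := by rw [Real.mul_self_sqrt hη.le, div_self hη.ne', mul_one]
    have hΛdiff : |Λ w - lam0| ≤ LΛ * Real.sqrt η := (hΛbound w hwK₀).trans (mul_le_mul_of_nonneg_left hwη hLΛ0)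
    -- `|V w| · |dΛ̃ v₁| ≤ √η · A`
    have hsecond : |V w * ((0 - dχ) * Λ w + (1 - χh w) * dΛv + dχ * lam0)| ≤ Real.sqrt η * A := by
      have h1 : (0 - dχ) * Λ w + (1 - χh w) * dΛv + dχ * lam0 = (1 - χh w) * dΛv + dχ * (lam0 - Λ w) := by ring
      rw [h1, abs_mul]
      have h2 : |(1 - χh w) * dΛv + dχ * (lam0 - Λ w)| ≤ LΛ * ‖v₁‖ + |dχ| * (LΛ * Real.sqrt η) := by
        calc |(1 - χh w) * dΛv + dχ * (lam0 - Λ w)| ≤ |(1 - χh w) * dΛv| + |dχ * (lam0 - Λ w)| := abs_add_le _ _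
          _ = |1 - χh w| * |dΛv| + |dχ| * |lam0 - Λ w| := by rw [abs_mul, abs_mul]
          _ ≤ 1 * (LΛ * ‖v₁‖) + |dχ| * (LΛ * Real.sqrt η) := by
              gcongr
              · show |1 - Real.smoothTransition (2 - 2 * (‖w - w₀‖ ^ 2 / η))| ≤ 1
                rw [abs_le]; constructor <;> linarith [hχw.1, hχw.2]
              · rw [abs_sub_comm]; exact hΛdiff
          _ = LΛ * ‖v₁‖ + |dχ| * (LΛ * Real.sqrt η) := by rw [one_mul]
      calc |V w| * |(1 - χh w) * dΛv + dχ * (lam0 - Λ w)|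
          ≤ (LV * Real.sqrt η) * (LΛ * ‖v₁‖ + |dχ| * (LΛ * Real.sqrt η)) :=
            mul_le_mul hVw h2 (abs_nonneg _) (by positivity)
        _ = Real.sqrt η * (LV * (LΛ * ‖v₁‖)) + Real.sqrt η * (LV * LΛ * (|dχ| * Real.sqrt η)) := by ring
        _ ≤ Real.sqrt η * (LV * (LΛ * ‖v₁‖)) + Real.sqrt η * (LV * LΛ * (2 * Cχ * ‖v₁‖)) := by
            gcongr
        _ = Real.sqrt η * A := by rw [hA]; ring
    have hfirst : lam0 / 4 ≤ dVv * ((1 - χh w) * Λ w + χh w * lam0) := by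
      have : (1:ℝ) / 2 * (lam0 / 2) ≤ dVv * ((1 - χh w) * Λ w + χh w * lam0) :=
        mul_le_mul hdVw hmixge (by positivity) (by linarith)
      linarith
    have habs := abs_le.1 hsecond
    linarith [habs.1, habs.2, hηsmall]
  -- ### critical points of `GN|Q` lie off the zone, where `GN = G`
  have hnewcrit_off : ∀ p : ↥Q, IsMCriticalPt (𝓡∂ 3) (GN ∘ Subtype.val : ↥Q → ℝ) p → p.1 ∉ Zs := by
    intro p hcr hpZ
    obtain ⟨hps, hdist⟩ := hZs_src p.1 hpZ
    have hσp : σ (dropLast 2 (D₀.Θ p.1)) = D₀.Θ p.1 := D₀.snocEquiv_dropLast_apply hps p.2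
    have hwB : dropLast 2 (D₀.Θ p.1) ∈ B₃ := by
      rw [hB₃, mem_ball, dist_eq_norm, ← hσnorm, hσp]
      exact lt_of_le_of_lt hdist hsqη
    rw [key_crit hGNs p hps hwB] at hcr
    refine hzone _ hwB ?_ hcr
    rw [← hσnorm, hσp]; exact hdist
  have holdcrit_off : ∀ p : ↥Q, IsMCriticalPt (𝓡∂ 3) (G ∘ Subtype.val : ↥Q → ℝ) p → p.1 ∉ Zs := by
    intro p hcr hpZ
    obtain ⟨hps, hdist⟩ := hZs_src p.1 hpZ
    exact hεnocrit p hps (lt_of_le_of_lt hdist hηε) hcr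
  have hlocal : ∀ p : ↥Q, p.1 ∉ Zs →
      (GN ∘ Subtype.val : ↥Q → ℝ) =ᶠ[𝓝 p] fun q => (G ∘ Subtype.val : ↥Q → ℝ) q + 0 := by
    intro p hp
    have h := hGN_far p.1 hp
    exact (continuous_subtype_val.continuousAt (x := p)).eventually h
  have hmorseN : ∀ p : ↥Q, IsMCriticalPt (𝓡∂ 3) (GN ∘ Subtype.val : ↥Q → ℝ) p →
      p.1 ∉ F ∧ (mhessian (𝓡∂ 3) (GN ∘ Subtype.val : ↥Q → ℝ) p).Nondegenerate := by
    intro p hcr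
    have hpZ := hnewcrit_off p hcr
    have hloc := hlocal p hpZ
    rw [isMCriticalPt_congr_of_eventuallyEq_add_const hloc] at hcr
    rw [mhessian_congr_of_eventuallyEq_add_const hloc]
    exact hcrit p hcr
  have hcountN : ∀ n, (criticalSetOfIndex (𝓡∂ 3) (GN ∘ Subtype.val : ↥Q → ℝ) n).ncard = c n := by
    intro n
    have hset : criticalSetOfIndex (𝓡∂ 3) (GN ∘ Subtype.val : ↥Q → ℝ) n =
        criticalSetOfIndex (𝓡∂ 3) (G ∘ Subtype.val : ↥Q → ℝ) n := by
      ext p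
      simp only [mem_criticalSetOfIndex]
      constructor
      · rintro ⟨hcr, hidx⟩
        have hloc := hlocal p (hnewcrit_off p hcr)
        refine ⟨?_, ?_⟩
        · rwa [isMCriticalPt_congr_of_eventuallyEq_add_const hloc] at hcr
        · unfold morseIndex at hidx ⊢
          rwa [mhessian_congr_of_eventuallyEq_add_const hloc] at hidx
      · rintro ⟨hcr, hidx⟩
        have hloc := hlocal p (holdcrit_off p hcr)
        refine ⟨?_, ?_⟩
        · rwa [isMCriticalPt_congr_of_eventuallyEq_add_const hloc]
        · unfold morseIndex at hidx ⊢
          rwa [mhessian_congr_of_eventuallyEq_add_const hloc]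
    rw [hset, hcount n]
  -- ### conclusion
  refine ⟨Φ, GN, lamN, Ol, Bx, hdet, hGNs, hlamNs, hOlo, hFOl, hOlU, hlamNpos, hGNform, hGNlt,
    ⟨hmorseN, hcountN⟩, hBxo, hxBx, fun y hy => hZs_Ol (hBxZs hy), fun y hy => ?_⟩
  rw [hlamN_Bx y hy, hlamN_Bx x hxBx]


end LambdaConst

end Literature.Topology.FourManifolds
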